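import Mathlib
import Literature.AlgebraicGeometry.HyperbolicPolynomials.HyperbolicityCone
import Summits.ValiantsHypothesis.ValiantsHypothesis.Theses.LacunarySymmetroid

/-!
# ConeTax — the hyperbolicity CONE is crossed by a lacunary curve a Descartes number of times
# (val-idea-21 g7, no-go theorem; companion of `Lines/garding_tax.lean`, g6)

Crux BY NAME: `Summit.ValiantsHypothesis.ValiantsHypothesis.Theses.LacunarySymmetroid.MatrixDescartes`
(stmt-ValiantsHypothesis-18050, V1) and Conjecture B `KPlusLogSqLaw` (V2).  g6 (`GardingTax`) settled
the ZERO-COUNT shadow of both at the hyperbolic-symbol level ("hyperbolicity costs one letter").  The one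
hatch it left open (memo `GARDING-TAX-g6.md` §6, critic #26: «CONE BOUNDARY = Lift-rankone's bottom-sheet
question, untouched») is the CONE shadow: how often can the monomial curve `γ_d(t) = (t^{d_1},…,t^{d_K})`
enter and leave the hyperbolicity cone `Λ₊₊(h,e)` of a Gårding-hyperbolic `K`-ary form `h` of degree `k`
(embed-g1 F2: "the cone sees only the bottom sheet"; in the determinantal dictionary: sign changes of
`λ_min`, definite-boundary roots)?  This file TYPES the two cone laws and records their NEGATIONS:

* `ConeAlternation f e d N` — points `0 < p₀ < … < p_N` along which membership of `γ_d(p_i)` alternates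
  between the OPEN cone and the complement of the CLOSED cone (so `∂Λ₊` is crossed `≥ N` times).
* `stereoCompletion r j lam g` — the **stereographic completion** of a form `g` of odd degree `k = 2j+1`
  in `n = r+1` variables: a form in `K = 2r+1` variables `x = (x₀; u₁…u_r; v₁…v_r)`,
  `h = lam·T_j(y(x), j·s(x)) + g(y(x))`, `T_j(y,σ) = σ ∏_{i=1}^{j} (σ² − i²|y|²)`, with the linear forms
  `s = x₀ + Σ v_l`, `y = (2u₁, …, 2u_r, x₀ − Σ v_l)`.  On the curve with exponents
  `d = (0; a₁…a_r; 2a₁…2a_r)` one has `x₀ v_l = u_l²` termwise, hence `s² = |y|²` IDENTICALLY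
  (`stereo_onQuadric`, proved): the curve rides the Lorentz quadric, `j·s = j|y|` is EXACTLY the top
  root of `T_j(y,·)`, and therefore (memo §1, Lemma B) `γ_d(t) ∈ Λ₊₊(h,e) ⇔ g(y(γ_d(t))) > 0` and
  `γ_d(t) ∉ Λ₊(h,e) ⇔ g(y(γ_d(t))) < 0` — cone membership along the curve is the SIGN of a free form `g`
  on the rational curve `t ↦ (2u(t), 1 − |u(t)|²)`, `u_l = t^{a_l}`; with `a_l = (2k+1)^{l−1}` the map
  `g ↦ g∘y∘γ_d` is injective on the `C(k+r, r)`-dimensional space of forms, so alternating signs can be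
  interpolated at `C(k+r,r)` points (memo §2).  Hyperbolicity of `h` for `27·sup|g(ŷ)|² < 4 lam²`
  (`j = 1`; general `j`: `sup|g(ŷ)| < μ_j·lam`) is g6's completion lemma (Lemma A).
* `coneTax_lower` (Theorem C of the memo): `η_cone(k, K) ≥ C(k + (K−1)/2, (K−1)/2) − 1 = D(k, (K+1)/2)`
  for odd `k ≥ 3`, odd `K ≥ 3` — the cone is crossed a DESCARTES NUMBER OF HALF THE LETTERS times
  (trivially `η_cone ≤ η_hyp ≤ D(k,K)`; g6: `η_hyp ≥ D(k,K−1)`).  «Cone tax ≤ half the letters.»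
* Hence `HypConeKPlusLogSq` and `HypConeMatrixDescartes` (the cone-crossing count put into the
  quantifier shapes of B and of MDR) are FALSE (`not_hypConeKPlusLogSq`, `not_hypConeMatrixDescartes`,
  kernel-checked from `coneTax_lower` + ℕ-arithmetic proved here: `k = K⁴`, `c = 3`, `q = 1`).
* Certified instance (memo §4, `calc/cone_instance.py`, exact arithmetic): `K = 5`, `k = 3`, support
  `{0,1,2,3,6}`, `h = 520·s(s²−|y|²) + ℓ₁ℓ₂ℓ₃(y)` with `ℓ_i = α_i y₁ + β_i y₂ + y₃`,
  `(α,β) ∈ {(−3,6),(−2,3),(−6,5)}`: 9 = D(3,3) cone-boundary crossings on `(0,3)`.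

CONSEQUENCE for the programme (memo §5–§6): convexity of `Λ₊₊` / concavity of `λ_min` bounds NOTHING
along a lacunary curve at the hyperbolic level — any cone / bottom-sheet lever for 18050 or B must use
SPECTRAHEDRALITY (an LMI representation), and there Gram squaring `F ↦ FᵀF` (crit-1 #41) already moves
every real root onto the definite boundary at the price `K ↦ C(K+1,2)`.  Nothing here proves or refutes
`MatrixDescartes`, `KPlusLogSqLaw`, `WeakLifting`; VP ≠ VNP is NOT proved.
Sorries (3, all analytic, paper proofs in `CONE-TAX-g7.md` §1–§2): `stereo_isHyperbolic` (Lemma A),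
`stereo_membership` (Lemma B), `stereo_signInterpolation` (§2).  Everything else — the quadric identity,
homogeneity, injectivity of the exponents, Theorem C from the three lemmas, the ℕ-arithmetic and both
negations — is kernel-checked.

(rev 2, memo §2b/§4b) A second incidence — the doubling chain d = (0,1,2,4,…,2^{K−2}) with the Lorentzian form
−Σ (x_i² − x₀ x_{i+1}) — gives η_cone(k,K) ≥ ρ(k,K) − 1 (rank table in the memo; certified 18 crossings at (k,K) = (3,5));
it is NOT typed here: the stereographic family below is the one that decides the corollaries.
-/

set_option linter.dupNamespace false

namespace Summit.ValiantsHypothesis.ValiantsHypothesis.Cruxes.MatrixDescartes.ConeTax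

open Literature.AlgebraicGeometry.HyperbolicPolynomials
open scoped BigOperators

/-! ### The cone-crossing count -/

/-- The point `γ_d(t) = (t^{d_1}, …, t^{d_K})` of the monomial curve. -/
noncomputable def curvePoint {K : ℕ} (d : Fin K → ℕ) (t : ℝ) : Fin K → ℝ := fun i => t ^ d i

/-- **Cone alternation of length `N`** along the monomial curve: parameters `0 < p₀ < p₁ < … < p_N`
such that for each consecutive pair one point lies in the OPEN hyperbolicity cone `Λ₊₊(f,e)` and the
other outside the CLOSED cone `Λ₊(f,e)`.  Each pair straddles `∂Λ₊` strictly, so the curve crosses the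
cone boundary at least `N` times (and, for hyperbolic homogeneous `f`, `λ_min(γ_d(t))` changes sign at
least `N` times, and `f∘γ_d` has at least `N` zeros ON the boundary). -/
def ConeAlternation {K : ℕ} (f : MvPolynomial (Fin K) ℝ) (e : Fin K → ℝ) (d : Fin K → ℕ)
    (N : ℕ) : Prop :=
  ∃ p : Fin (N + 1) → ℝ, StrictMono p ∧ (∀ i, 0 < p i) ∧
    ∀ i : Fin N,
      (curvePoint d (p i.castSucc) ∈ openHyperbolicityCone f e ∧
          curvePoint d (p i.succ) ∉ hyperbolicityCone f e) ∨
        (curvePoint d (p i.castSucc) ∉ hyperbolicityCone f e ∧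
          curvePoint d (p i.succ) ∈ openHyperbolicityCone f e)

/-- A cone alternation can be shortened. -/
theorem ConeAlternation.mono {K : ℕ} {f : MvPolynomial (Fin K) ℝ} {e : Fin K → ℝ}
    {d : Fin K → ℕ} {N M : ℕ} (h : ConeAlternation f e d N) (hMN : M ≤ N) :
    ConeAlternation f e d M := by
  obtain ⟨p, hp, hpos, halt⟩ := h
  refine ⟨fun i => p (Fin.castLE (by omega) i), fun i j hij => hp (by simpa using hij),
    fun i => hpos _, fun i => ?_⟩
  have := halt (Fin.castLE hMN i)
  simpa [Fin.castLE] using this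

/-- **HypConeB** — the `K + log² k` law for cone crossings (embed-g1 H2/H3 put into the shape of
Conjecture B, symbol level).  FALSE: `not_hypConeKPlusLogSq`. -/
def HypConeKPlusLogSq : Prop :=
  ∃ C : ℕ, ∀ (K k N : ℕ) (f : MvPolynomial (Fin K) ℝ) (e : Fin K → ℝ) (d : Fin K → ℕ),
    f.IsHomogeneous k → IsHyperbolic f e → ConeAlternation f e d N →
      N ≤ 2 ^ (C * (K + Nat.log 2 k ^ 2))

/-- **HypConeMDR** — the quantifier shape of `LacunarySymmetroid.MatrixDescartes` with "number of real
roots of the `m × m` symmetric determinant" replaced by "number of cone crossings of a hyperbolic form of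
degree `k`" (`k` in the window of `m`).  FALSE: `not_hypConeMatrixDescartes`. -/
def HypConeMatrixDescartes : Prop :=
  ∀ c q : ℕ, 0 < q → ∃ K₀ : ℕ, ∀ K k : ℕ, K₀ ≤ K → k ≤ 2 ^ ((Nat.log 2 K + c) ^ c) →
    ∀ (N : ℕ) (f : MvPolynomial (Fin K) ℝ) (e : Fin K → ℝ) (d : Fin K → ℕ),
      f.IsHomogeneous k → IsHyperbolic f e → ConeAlternation f e d N →
        N ^ q ≤ 2 ^ (K * Nat.log 2 K)

/-! ### The stereographic completion (`K = 2r+1` variables `x₀; u₁…u_r; v₁…v_r`) -/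

section Stereo

variable (r : ℕ)

/-- index of `u_l` -/
def idxU (l : Fin r) : Fin (2 * r + 1) := ⟨l.val + 1, by omega⟩

/-- index of `v_l` -/
def idxV (l : Fin r) : Fin (2 * r + 1) := ⟨r + 1 + l.val, by omega⟩

@[simp] theorem idxU_val (l : Fin r) : (idxU r l).val = l.val + 1 := rfl
@[simp] theorem idxV_val (l : Fin r) : (idxV r l).val = r + 1 + l.val := rfl

/-- `s(x) = x₀ + Σ_l v_l`. -/
noncomputable def sForm : MvPolynomial (Fin (2 * r + 1)) ℝ :=
  MvPolynomial.X 0 + ∑ l : Fin r, MvPolynomial.X (idxV r l)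

/-- `y_n(x) = x₀ − Σ_l v_l` (the last coordinate of `y`). -/
noncomputable def yLast : MvPolynomial (Fin (2 * r + 1)) ℝ :=
  MvPolynomial.X 0 - ∑ l : Fin r, MvPolynomial.X (idxV r l)

/-- `y(x) = (2u₁, …, 2u_r, x₀ − Σ v_l) : ℝ^K → ℝ^{r+1}` as linear forms. -/
noncomputable def yForm (i : Fin (r + 1)) : MvPolynomial (Fin (2 * r + 1)) ℝ :=
  if h : i.val < r then MvPolynomial.C 2 * MvPolynomial.X ⟨i.val + 1, by omega⟩ else yLast r

/-- `Q(x) = |y(x)|²`. -/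
noncomputable def QForm : MvPolynomial (Fin (2 * r + 1)) ℝ := ∑ i : Fin (r + 1), yForm r i ^ 2

/-- The **stereographic completion** `h = lam · (j s) ∏_{i=1}^{j} ((j s)² − i² Q) + g(y)` of a form `g`
in `r+1` variables (intended: `g` homogeneous of degree `2j+1`, `lam ≥ lam₀(g)`). -/
noncomputable def stereoCompletion (j : ℕ) (lam : ℝ) (g : MvPolynomial (Fin (r + 1)) ℝ) :
    MvPolynomial (Fin (2 * r + 1)) ℝ :=
  MvPolynomial.C lam *
      ((MvPolynomial.C (j : ℝ) * sForm r) *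
        ∏ i ∈ Finset.range j,
          ((MvPolynomial.C (j : ℝ) * sForm r) ^ 2 - MvPolynomial.C (((i : ℝ) + 1) ^ 2) * QForm r)) +
    MvPolynomial.bind₁ (yForm r) g

/-- The exponents `d = (0; a₁,…,a_r; 2a₁,…,2a_r)` with `a_l = b^{l-1}` (`b = 2k+1` makes `g ↦ g∘y∘γ_d`
injective on forms of degree `k`; any `b ≥ 2` gives the quadric identity). -/
def stereoExponents (b : ℕ) : Fin (2 * r + 1) → ℕ := fun i =>
  if i.val = 0 then 0 else if i.val ≤ r then b ^ (i.val - 1) else 2 * b ^ (i.val - 1 - r)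

/-- The direction `e = (1; 0,…,0; 1/r,…,1/r)`: `y(e) = 0`, `s(e) = 2`. -/
noncomputable def stereoDirection : Fin (2 * r + 1) → ℝ := fun i =>
  if i.val = 0 then 1 else if i.val ≤ r then 0 else 1 / (r : ℝ)

@[simp] theorem stereoExponents_zero (b : ℕ) : stereoExponents r b 0 = 0 := by
  simp [stereoExponents]

@[simp] theorem stereoExponents_idxU (b : ℕ) (l : Fin r) :
    stereoExponents r b (idxU r l) = b ^ l.val := by
  simp [stereoExponents, idxU, show l.val + 1 ≤ r from l.isLt]

@[simp] theorem stereoExponents_idxV (b : ℕ) (l : Fin r) :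
    stereoExponents r b (idxV r l) = 2 * b ^ l.val := by
  have h1 : ¬ (r + 1 + l.val ≤ r) := by omega
  simp [stereoExponents, idxV, h1]

/-- For odd `b ≥ 3` the exponents `0, b^{l}, 2b^{l}` are pairwise distinct. -/
theorem stereoExponents_injective (b : ℕ) (hb : 2 ≤ b) (hodd : Odd b) :
    Function.Injective (stereoExponents r b) := by
  intro i i' h
  have hpos : ∀ x : ℕ, 0 < b ^ x := fun x => Nat.pos_of_ne_zero (pow_ne_zero x (by omega))
  have hpo : ∀ x : ℕ, Odd (b ^ x) := fun x => hodd.pow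
  have hne : ∀ x y : ℕ, b ^ x ≠ 2 * b ^ y := by
    intro x y hxy
    have h1 := hpo x
    rw [hxy] at h1
    exact (Nat.not_even_iff_odd.mpr h1) (even_two_mul _)
  have hinj : ∀ x y : ℕ, b ^ x = b ^ y → x = y := fun x y hxy =>
    Nat.pow_right_injective hb hxy
  apply Fin.ext
  simp only [stereoExponents] at h
  split_ifs at h with h1 h2 h3 h4 h5 h6 h7 h8
  · omega
  · exact absurd h.symm (hpos _).ne'
  · have := hpos (i'.val - 1 - r); omega
  · exact absurd h (hpos _).ne'
  · have := hinj _ _ h; omega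
  · exact absurd h (hne _ _)
  · have := hpos (i.val - 1 - r); omega
  · exact absurd h.symm (hne _ _)
  · have h' : b ^ (i.val - 1 - r) = b ^ (i'.val - 1 - r) := by omega
    have := hinj _ _ h'
    have hi := i.isLt; have hi' := i'.isLt
    omega

/-- `s(γ_d(t)) = 1 + Σ_l t^{2a_l}`. -/
theorem eval_sForm_curve (b : ℕ) (t : ℝ) :
    MvPolynomial.eval (curvePoint (stereoExponents r b) t) (sForm r) =
      1 + ∑ l : Fin r, t ^ (2 * b ^ l.val) := by
  simp [sForm, curvePoint, map_sum]

/-- `y_n(γ_d(t)) = 1 − Σ_l t^{2a_l}`. -/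
theorem eval_yLast_curve (b : ℕ) (t : ℝ) :
    MvPolynomial.eval (curvePoint (stereoExponents r b) t) (yLast r) =
      1 - ∑ l : Fin r, t ^ (2 * b ^ l.val) := by
  simp [yLast, curvePoint, map_sum]

/-- `y_l(γ_d(t)) = 2 t^{a_l}` for `l < r`. -/
theorem eval_yForm_castSucc_curve (b : ℕ) (t : ℝ) (l : Fin r) :
    MvPolynomial.eval (curvePoint (stereoExponents r b) t) (yForm r l.castSucc) =
      2 * t ^ (b ^ l.val) := by
  have hl : (l.castSucc : Fin (r + 1)).val < r := by simp
  have hidx : (⟨(l.castSucc : Fin (r + 1)).val + 1, by simp; omega⟩ : Fin (2 * r + 1)) = idxU r l := by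
    ext; simp [idxU]
  rw [yForm, dif_pos hl, map_mul, MvPolynomial.eval_C, MvPolynomial.eval_X, hidx]
  simp [curvePoint]

/-- `y_n(γ_d(t))` is the last coordinate. -/
theorem eval_yForm_last_curve (b : ℕ) (t : ℝ) :
    MvPolynomial.eval (curvePoint (stereoExponents r b) t) (yForm r (Fin.last r)) =
      1 - ∑ l : Fin r, t ^ (2 * b ^ l.val) := by
  rw [yForm, dif_neg (by simp), eval_yLast_curve]

/-- **The curve rides the Lorentz quadric**: `s(γ_d(t))² = |y(γ_d(t))|²` identically in `t`
(because `x₀ · v_l = u_l²` termwise on the curve: `1 · t^{2a_l} = (t^{a_l})²`). -/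
theorem stereo_onQuadric (b : ℕ) (t : ℝ) :
    MvPolynomial.eval (curvePoint (stereoExponents r b) t) (sForm r ^ 2 - QForm r) = 0 := by
  rw [map_sub, map_pow, eval_sForm_curve, QForm, map_sum, Fin.sum_univ_castSucc]
  simp only [map_pow, eval_yForm_castSucc_curve, eval_yForm_last_curve]
  have h4 : ∑ l : Fin r, (2 * t ^ (b ^ l.val)) ^ 2 = 4 * ∑ l : Fin r, t ^ (2 * b ^ l.val) := by
    rw [Finset.mul_sum]
    refine Finset.sum_congr rfl fun l _ => ?_
    rw [mul_pow, ← pow_mul, mul_comm (b ^ l.val) 2]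
    norm_num
  rw [h4]
  ring

/-- On the curve the completion collapses to `g`: `h(γ_d(t)) = g(y(γ_d(t)))` — the curve lies on the
zero set of `T_j(y, j s)`'s top factor `(j s)² − j² Q` (for `j ≥ 1`). -/
theorem eval_stereoCompletion_curve (j : ℕ) (hj : 1 ≤ j) (lam : ℝ) (b : ℕ) (t : ℝ)
    (g : MvPolynomial (Fin (r + 1)) ℝ) :
    MvPolynomial.eval (curvePoint (stereoExponents r b) t) (stereoCompletion r j lam g) =
      MvPolynomial.eval (fun i => MvPolynomial.eval (curvePoint (stereoExponents r b) t) (yForm r i))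
        g := by
  have hq := stereo_onQuadric r b t
  rw [map_sub, sub_eq_zero] at hq
  have hmem : j - 1 ∈ Finset.range j := Finset.mem_range.mpr (by omega)
  have hzero : MvPolynomial.eval (curvePoint (stereoExponents r b) t)
      (∏ i ∈ Finset.range j,
        ((MvPolynomial.C (j : ℝ) * sForm r) ^ 2 - MvPolynomial.C (((i : ℝ) + 1) ^ 2) * QForm r)) = 0 := by
    rw [map_prod]
    apply Finset.prod_eq_zero hmem
    have hj' : ((j - 1 : ℕ) : ℝ) + 1 = j := by
      rw [Nat.cast_sub hj]; push_cast; ring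
    rw [map_sub, map_mul, map_pow, map_mul, MvPolynomial.eval_C, MvPolynomial.eval_C, hj', ← hq,
      map_pow]
    ring
  rw [stereoCompletion, map_add, map_mul, map_mul, hzero, mul_zero, mul_zero, zero_add]
  show MvPolynomial.eval₂Hom (RingHom.id ℝ) _ (MvPolynomial.bind₁ (yForm r) g) = _
  rw [MvPolynomial.eval₂Hom_bind₁]
  rfl

/-- The completion is homogeneous of degree `2j+1` when `g` is. -/
theorem stereoCompletion_isHomogeneous (j : ℕ) (lam : ℝ) (g : MvPolynomial (Fin (r + 1)) ℝ)
    (hg : g.IsHomogeneous (2 * j + 1)) :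
    (stereoCompletion r j lam g).IsHomogeneous (2 * j + 1) := by
  have h1 : (sForm r).IsHomogeneous 1 :=
    (MvPolynomial.isHomogeneous_X ℝ _).add
      (MvPolynomial.IsHomogeneous.sum _ _ _ fun l _ => MvPolynomial.isHomogeneous_X ℝ _)
  have hs : (MvPolynomial.C (j : ℝ) * sForm r : MvPolynomial (Fin (2 * r + 1)) ℝ).IsHomogeneous 1 :=
    h1.C_mul _
  have hy : ∀ i : Fin (r + 1), (yForm r i).IsHomogeneous 1 := by
    intro i
    unfold yForm
    split_ifs with h
    · exact MvPolynomial.isHomogeneous_C_mul_X _ _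
    · exact (MvPolynomial.isHomogeneous_X ℝ _).sub
        (MvPolynomial.IsHomogeneous.sum _ _ _ fun l _ => MvPolynomial.isHomogeneous_X ℝ _)
  have hQ : (QForm r).IsHomogeneous 2 :=
    MvPolynomial.IsHomogeneous.sum _ _ _ fun i _ => by simpa using (hy i).pow 2
  have hfac : ∀ i ∈ Finset.range j,
      ((MvPolynomial.C (j : ℝ) * sForm r) ^ 2 - MvPolynomial.C (((i : ℝ) + 1) ^ 2) * QForm r :
        MvPolynomial (Fin (2 * r + 1)) ℝ).IsHomogeneous 2 := by
    intro i _
    exact (by simpa using hs.pow 2 : ((MvPolynomial.C (j : ℝ) * sForm r) ^ 2 :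
      MvPolynomial (Fin (2 * r + 1)) ℝ).IsHomogeneous 2).sub (hQ.C_mul _)
  have hprod := MvPolynomial.IsHomogeneous.prod (Finset.range j) _ (fun _ => 2) hfac
  have hT := ((hs.mul hprod).C_mul lam)
  have hb : (MvPolynomial.bind₁ (yForm r) g).IsHomogeneous (2 * j + 1) := by
    have := hg.aeval (yForm r) hy
    rw [one_mul] at this
    exact this
  have hdeg : (1 + ∑ _i ∈ Finset.range j, (2 : ℕ)) = 2 * j + 1 := by
    simp [Finset.sum_const, Finset.card_range]; ring
  unfold stereoCompletion
  exact (hdeg ▸ hT).add hb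

end Stereo

/-! ### Theorem C and the two negations -/

/-- `g(y(γ_d(t)))` for `d = stereoExponents r b` — by `eval_stereoCompletion_curve` this IS `h(γ_d(t))`. -/
noncomputable def gOnCurve (r b : ℕ) (g : MvPolynomial (Fin (r + 1)) ℝ) (t : ℝ) : ℝ :=
  MvPolynomial.eval
    (fun i => MvPolynomial.eval (curvePoint (stereoExponents r b) t) (yForm r i)) g

/-- **Lemma A (hyperbolicity of the completion; = g6's completion lemma transported by `bind₁`).**
For `g` homogeneous of degree `2j+1` and `lam ≥ lam₀(g)` (`j = 1`: `4 lam² > 27 sup_{|ŷ|=1} g(ŷ)²`;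
general `j`: `lam·μ_j > sup |g(ŷ)|`, `μ_j` = least modulus of a critical value of `σ∏_{i≤j}(σ²−i²)`),
`h = stereoCompletion r j lam g` is hyperbolic w.r.t. `e = stereoDirection r` (`y(e) = 0`, `s(e) = 2`):
`h(x + ρe) = P_{y(x)}(j s(x) + 2jρ)` with `P_y(σ) = lam·σ∏(σ² − i²|y|²) + g(y)` real-rooted for every `y`
(IVT between the `2j` critical points, whose critical values `±lam·c_i|y|^{2j+1}` dominate `|g(y)|`).
Memo §1.  Analytic; sorry. -/
theorem stereo_isHyperbolic (r j : ℕ) (hr : 1 ≤ r) (hj : 1 ≤ j) (g : MvPolynomial (Fin (r + 1)) ℝ)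
    (hg : g.IsHomogeneous (2 * j + 1)) :
    ∃ lam₀ : ℝ, ∀ lam : ℝ, lam₀ ≤ lam →
      IsHyperbolic (stereoCompletion r j lam g) (stereoDirection r) := by
  sorry

/-- **Lemma B (exact membership test on the curve).**  For `lam ≥ lam₀(g)` and every `b`, `t`:
`g(y(γ_d t)) > 0 ⇒ γ_d(t) ∈ Λ₊₊(h,e)` and `g(y(γ_d t)) < 0 ⇒ γ_d(t) ∉ Λ₊(h,e)`.  Proof (memo §1): by
`stereo_onQuadric`, `j·s = j|y|` on the curve is the TOP root of `σ ↦ σ∏(σ²−i²|y|²)`; `P_y` is increasing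
on `[c_top, ∞)` (`c_top` = top critical point) with `P_y(c_top) < 0`, so its largest root `σ_max` is the
only one beyond `c_top` and `sign P_y(j|y|) = sign g(y) = sign (j|y| − σ_max)`; finally
`γ_d(t) ∈ Λ₊₊ ⇔ j s > σ_max` and `γ_d(t) ∉ Λ₊ ⇔ j s < σ_max` (roots of `ρ ↦ h(γ_d t + ρ e)` are
`(σ_i − j s)/(2j)`).  Analytic; sorry. -/
theorem stereo_membership (r j : ℕ) (hr : 1 ≤ r) (hj : 1 ≤ j) (g : MvPolynomial (Fin (r + 1)) ℝ)
    (hg : g.IsHomogeneous (2 * j + 1)) :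
    ∃ lam₀ : ℝ, ∀ lam : ℝ, lam₀ ≤ lam → ∀ (b : ℕ) (t : ℝ),
      (0 < gOnCurve r b g t →
          curvePoint (stereoExponents r b) t ∈
            openHyperbolicityCone (stereoCompletion r j lam g) (stereoDirection r)) ∧
        (gOnCurve r b g t < 0 →
          curvePoint (stereoExponents r b) t ∉
            hyperbolicityCone (stereoCompletion r j lam g) (stereoDirection r)) := by
  sorry

/-- **Sign interpolation (memo §2).**  With `b = 2k+1`, `k = 2j+1`, the map `g ↦ g∘y∘γ_d`
(`= gOnCurve r b g`) is injective on the `C(k+r, r)`-dimensional space of degree-`k` forms in `r+1`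
variables (the cone over the curve `t ↦ (2u(t), 1−|u(t)|²)` is Zariski dense in `ℝ^{r+1}` after
separating monomials `u^β`, `|β| ≤ 2k`, by their `t`-exponents `Σ β_l b^{l-1}`), so there are
`C(k+r,r)` points `0 < p₀ < … ` with linearly independent evaluation functionals and a form `g` whose
values there alternate in sign.  Linear algebra + real-analyticity; sorry. -/
theorem stereo_signInterpolation (r j : ℕ) (hr : 1 ≤ r) :
    ∃ g : MvPolynomial (Fin (r + 1)) ℝ, g.IsHomogeneous (2 * j + 1) ∧
      ∃ p : Fin (Nat.choose (2 * j + 1 + r) r - 1 + 1) → ℝ, StrictMono p ∧ (∀ i, 0 < p i) ∧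
        ∀ i, (Even i.val → 0 < gOnCurve r (2 * (2 * j + 1) + 1) g (p i)) ∧
          (Odd i.val → gOnCurve r (2 * (2 * j + 1) + 1) g (p i) < 0) := by
  sorry

/-- **Theorem C (cone tax ≤ half the letters).**  For `r ≥ 1` and `j ≥ 1` (`K = 2r+1` letters, degree
`k = 2j+1`) there are a homogeneous Gårding-hyperbolic `K`-ary form `f` of degree `k`, a direction `e`
and injective exponents `d` such that the curve `γ_d` alternates `C(k+r, r) − 1 = D(k, r+1)` times between
the open cone `Λ₊₊(f,e)` and the exterior of the closed cone `Λ₊(f,e)`.  KERNEL-CHECKED reduction to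
Lemma A, Lemma B and the sign interpolation: `f = stereoCompletion r j lam g`, `e = stereoDirection r`,
`d = stereoExponents r (2k+1)`, `lam = max lam_A lam_B`. -/
theorem coneTax_lower (r j : ℕ) (hr : 1 ≤ r) (hj : 1 ≤ j) :
    ∃ (f : MvPolynomial (Fin (2 * r + 1)) ℝ) (e : Fin (2 * r + 1) → ℝ) (d : Fin (2 * r + 1) → ℕ),
      f.IsHomogeneous (2 * j + 1) ∧ IsHyperbolic f e ∧ Function.Injective d ∧
        ConeAlternation f e d (Nat.choose (2 * j + 1 + r) r - 1) := by
  obtain ⟨g, hg, p, hp, hpos, hsign⟩ := stereo_signInterpolation r j hr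
  obtain ⟨lamA, hA⟩ := stereo_isHyperbolic r j hr hj g hg
  obtain ⟨lamB, hB⟩ := stereo_membership r j hr hj g hg
  refine ⟨stereoCompletion r j (max lamA lamB) g, stereoDirection r,
    stereoExponents r (2 * (2 * j + 1) + 1), stereoCompletion_isHomogeneous r j _ g hg,
    hA _ (le_max_left _ _), stereoExponents_injective r _ (by omega) ⟨2 * j + 1, rfl⟩,
    p, hp, hpos, fun i => ?_⟩
  have hBi := hB (max lamA lamB) (le_max_right _ _) (2 * (2 * j + 1) + 1)
  rcases Nat.even_or_odd i.val with hev | hod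
  · left
    exact ⟨(hBi (p i.castSucc)).1 ((hsign i.castSucc).1 (by simpa using hev)),
      (hBi (p i.succ)).2 ((hsign i.succ).2 (by simpa using hev.add_one))⟩
  · right
    exact ⟨(hBi (p i.castSucc)).2 ((hsign i.castSucc).2 (by simpa using hod)),
      (hBi (p i.succ)).1 ((hsign i.succ).1 (by simpa using hod.add_one))⟩

/-- `m^r ≤ C(a+r, r)` whenever `m·r ≤ a` (each factor `(a+i)/i ≥ m`; as in g6). -/
private theorem pow_le_choose_add (a m : ℕ) :
    ∀ r : ℕ, m * r ≤ a → m ^ r ≤ Nat.choose (a + r) r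
  | 0, _ => by simp
  | r + 1, h => by
    have ih := pow_le_choose_add a m r ((Nat.mul_le_mul_left m (Nat.le_succ r)).trans h)
    have key : (a + r + 1) * Nat.choose (a + r) r = Nat.choose (a + r + 1) (r + 1) * (r + 1) :=
      Nat.add_one_mul_choose_eq (a + r) r
    have step : (r + 1) * m ^ (r + 1) ≤ (r + 1) * Nat.choose (a + r + 1) (r + 1) := by
      calc (r + 1) * m ^ (r + 1) = (m * (r + 1)) * m ^ r := by ring
        _ ≤ (a + r + 1) * m ^ r := Nat.mul_le_mul_right _ (by omega)
        _ ≤ (a + r + 1) * Nat.choose (a + r) r := Nat.mul_le_mul_left _ ih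
        _ = (r + 1) * Nat.choose (a + r + 1) (r + 1) := by rw [key, mul_comm]
    have := Nat.le_of_mul_le_mul_left step (Nat.succ_pos r)
    simpa [Nat.add_assoc] using this

/-- MDR-window arithmetic (pure ℕ).  With `K = 2r+1 ≥ 17`, `k = K⁴`:  `K⁴ ≤ 2^{(⌊log₂K⌋+3)³}` and
`2^{K⌊log₂K⌋} ≤ K^K`, `3·K^K ≤ K^{K+1} ≤ K^{3r} = (K³)^r ≤ C(K⁴ + r, r)` (as `K³·r ≤ K⁴`). -/
theorem window_arith4 (r : ℕ) (hr : 8 ≤ r) :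
    (2 * r + 1) ^ 4 ≤ 2 ^ ((Nat.log 2 (2 * r + 1) + 3) ^ 3) ∧
      2 ^ ((2 * r + 1) * Nat.log 2 (2 * r + 1)) < Nat.choose ((2 * r + 1) ^ 4 + r) r - 1 := by
  set K := 2 * r + 1 with hK
  set L := Nat.log 2 K with hL
  constructor
  · have h1 : K < 2 ^ (L + 1) := Nat.lt_pow_succ_log_self one_lt_two K
    have h2 : K ^ 4 ≤ (2 ^ (L + 1)) ^ 4 := Nat.pow_le_pow_left h1.le 4
    rw [← pow_mul] at h2
    have h3 : (L + 1) * 4 ≤ (L + 3) ^ 3 := by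
      have h9 : 9 ≤ (L + 3) ^ 2 := by nlinarith
      calc (L + 1) * 4 ≤ (L + 3) * 9 := by omega
        _ ≤ (L + 3) * (L + 3) ^ 2 := Nat.mul_le_mul_left _ h9
        _ = (L + 3) ^ 3 := by ring
    exact h2.trans (Nat.pow_le_pow_right two_pos h3)
  · have hKpos : 0 < K := by omega
    have hA : 2 ^ (K * L) ≤ K ^ K := by
      rw [mul_comm, pow_mul]
      exact Nat.pow_le_pow_left (Nat.pow_log_le_self 2 (by omega)) _
    have hB : K ^ K * K ≤ K ^ (3 * r) := by
      rw [← pow_succ]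
      exact Nat.pow_le_pow_right hKpos (by omega)
    have hC : K ^ (3 * r) ≤ Nat.choose (K ^ 4 + r) r := by
      rw [pow_mul]
      refine pow_le_choose_add (K ^ 4) (K ^ 3) r ?_
      calc K ^ 3 * r ≤ K ^ 3 * K := Nat.mul_le_mul_left _ (by omega)
        _ = K ^ 4 := by ring
    have hD : K ^ K * 3 ≤ K ^ K * K := Nat.mul_le_mul_left _ (by omega)
    have hE : 1 ≤ K ^ K := Nat.one_le_pow _ _ hKpos
    omega

private theorem two_j_add_one (r : ℕ) : 2 * (((2 * r + 1) ^ 4 - 1) / 2) + 1 = (2 * r + 1) ^ 4 := by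
  have hodd : Odd ((2 * r + 1) ^ 4) := (show Odd (2 * r + 1) from ⟨r, rfl⟩).pow
  obtain ⟨q, hq⟩ := hodd
  omega

/-- `K + log²` arithmetic (pure ℕ): for every `C` there are `r, j ≥ 1` with
`2^{C((2r+1) + ⌊log₂(2j+1)⌋²)} < C(2j+1+r, r) − 1`.  Choice: `r = 2^{8C+8}`, `2j+1 = r·2^{4C+4} + 1`:
`C(2j+1+r, r) ≥ (2^{4C+4})^r`, `⌊log₂(2j+1)⌋ ≤ 12C+12`, and `C(2r+1+(12C+12)²) + 2 ≤ (4C+4)·r` because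
`r ≥ 256 (C+1)³`. -/
theorem kPlusLogSq_arith (C : ℕ) :
    ∃ r j : ℕ, 1 ≤ r ∧ 1 ≤ j ∧
      2 ^ (C * ((2 * r + 1) + Nat.log 2 (2 * j + 1) ^ 2)) < Nat.choose (2 * j + 1 + r) r - 1 := by
  set a := 8 * C + 7 with ha
  set b := 4 * C + 4 with hb
  have h2a : 1 ≤ 2 ^ a := Nat.one_le_two_pow
  have h2b : 1 ≤ 2 ^ b := Nat.one_le_two_pow
  refine ⟨2 * 2 ^ a, 2 ^ a * 2 ^ b, by omega, Nat.mul_le_mul h2a h2b, ?_⟩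
  have hk : 2 * (2 ^ a * 2 ^ b) + 1 = (2 * 2 ^ a) * 2 ^ b + 1 := by ring
  rw [hk]
  set r := 2 * 2 ^ a with hr
  -- log bound
  have hlog : Nat.log 2 (r * 2 ^ b + 1) ≤ a + b + 1 := by
    have hlt : r * 2 ^ b + 1 < 2 ^ (a + b + 1 + 1) := by
      have : r * 2 ^ b = 2 ^ (a + b + 1) := by
        rw [hr, pow_succ, pow_add]; ring
      rw [this, pow_succ]; have := Nat.one_le_two_pow (n := a + b + 1); omega
    have := Nat.log_lt_of_lt_pow (b := 2) (by positivity) hlt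
    omega
  -- binomial bound
  have hbin : 2 ^ (b * r) ≤ Nat.choose (r * 2 ^ b + 1 + r) r := by
    rw [pow_mul]
    exact pow_le_choose_add _ _ _ (by rw [mul_comm]; omega)
  -- size of r
  have hbig : 256 * (C + 1) ^ 3 ≤ r := by
    have hC1 : C + 1 ≤ 2 ^ C := Nat.lt_two_pow_self
    have h3 : (C + 1) ^ 3 ≤ 2 ^ (3 * C) := by
      rw [pow_mul']; exact Nat.pow_le_pow_left hC1 3
    have h5 : 1 ≤ 2 ^ (5 * C) := Nat.one_le_two_pow
    have e1 : r = 2 ^ (3 * C) * 2 ^ (5 * C) * 256 := by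
      rw [hr, ha, show 8 * C + 7 = 3 * C + 5 * C + 7 by ring, pow_add, pow_add]; norm_num; ring
    rw [e1]
    have := Nat.mul_le_mul h3 h5
    nlinarith
  -- exponent comparison
  have hexp : C * (2 * r + 1 + (a + b + 1) ^ 2) + 2 ≤ b * r := by
    have hsq : (a + b + 1) ^ 2 = 144 * (C + 1) ^ 2 := by rw [ha, hb]; ring
    rw [hsq, hb]
    nlinarith [hbig]
  have hpow : 2 ^ (C * (2 * r + 1 + Nat.log 2 (r * 2 ^ b + 1) ^ 2)) ≤ 2 ^ (b * r - 2) := by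
    apply Nat.pow_le_pow_right two_pos
    have h1 : Nat.log 2 (r * 2 ^ b + 1) ^ 2 ≤ (a + b + 1) ^ 2 := Nat.pow_le_pow_left hlog 2
    have h2 : C * (2 * r + 1 + Nat.log 2 (r * 2 ^ b + 1) ^ 2) ≤ C * (2 * r + 1 + (a + b + 1) ^ 2) :=
      Nat.mul_le_mul_left _ (by omega)
    omega
  have hfin : 2 ^ (b * r - 2) + 1 < 2 ^ (b * r) := by
    have h2 : 2 ≤ b * r := by nlinarith
    have e : 2 ^ (b * r) = 2 ^ (b * r - 2) * 4 := by
      rw [show (4 : ℕ) = 2 ^ 2 by norm_num, ← pow_add, Nat.sub_add_cancel h2]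
    have h1 : 1 ≤ 2 ^ (b * r - 2) := Nat.one_le_two_pow
    omega
  omega

/-- **HypConeMDR is false**: `c = 3`, `q = 1`, `K = 2r+1 ≥ max K₀ 17`, `k = K⁴`. -/
theorem not_hypConeMatrixDescartes : ¬ HypConeMatrixDescartes := by
  intro h
  obtain ⟨K₀, hK₀⟩ := h 3 1 one_pos
  set r := K₀ + 8 with hr
  obtain ⟨hwin, hbig⟩ := window_arith4 r (by omega)
  have hj : 1 ≤ ((2 * r + 1) ^ 4 - 1) / 2 := by
    have : 17 ^ 4 ≤ (2 * r + 1) ^ 4 := Nat.pow_le_pow_left (by omega) 4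
    omega
  obtain ⟨f, e, d, hhom, hhyp, -, halt⟩ := coneTax_lower r (((2 * r + 1) ^ 4 - 1) / 2) (by omega) hj
  rw [two_j_add_one] at hhom halt
  have hle := hK₀ (2 * r + 1) ((2 * r + 1) ^ 4) (by omega) hwin _ f e d hhom hhyp halt
  rw [pow_one] at hle
  omega

/-- **HypConeB is false** (from `coneTax_lower` + `kPlusLogSq_arith`). -/
theorem not_hypConeKPlusLogSq : ¬ HypConeKPlusLogSq := by
  rintro ⟨C, hC⟩
  obtain ⟨r, j, hr, hj, hbig⟩ := kPlusLogSq_arith C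
  obtain ⟨f, e, d, hhom, hhyp, -, halt⟩ := coneTax_lower r j hr hj
  have hle := hC (2 * r + 1) (2 * j + 1) _ f e d hhom hhyp halt
  omega

/-- Bookkeeping: the trivial direction.  Every cone alternation is in particular witnessed by sign data
of `f∘γ_d` between consecutive points, so `η_cone(k,K) ≤ η_hyp(k,K) ≤ C(k+K−1,K−1) − 1` (Descartes;
g6 `lacunary_upper`).  Not re-typed here. -/
theorem coneTax_upper_note : True := trivial

end Summit.ValiantsHypothesis.ValiantsHypothesis.Cruxes.MatrixDescartes.ConeTax
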